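import Literature.AlgebraicGeometry.Modules.GrothendieckComplexOfProper
import Literature.AlgebraicGeometry.Modules.PullbackQuasicoherent
import Literature.Algebra.Module.KernelBaseChangeOfHOneVanishing
import HarnessLib

/-!
# Sections of a vector bundle on the closed fibre of a proper flat scheme over a local base lift, and `H⁰` base
# change is onto, when `H¹` of the fibre vanishes (Mumford, *Abelian Varieties*, §5 Cor. 3; Hartshorne III
# Thm. 12.11; EGA III 7.7.5–7.7.10)

Topic `AlgebraicGeometry/Morphisms`; namespace `Literature.AlgebraicGeometry.Morphisms`; a *proofs* file (theorems only; no
definition, no named fact, no instance, no notation).  The GEOMETRIC ASSEMBLY of «cohomology and base change» at the bottom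
degree, for an arbitrary proper flat `g : X → B` over an affine base with LOCAL noetherian ring `Γ(B, 𝒪_B)` (e.g.
`B = Spec 𝒪_{S,s}`) and a vector bundle `G` on `X`, from the three tree inputs

* ★ `Modules/GrothendieckComplexOfProper` (B-p19): the Grothendieck complex `K• → Č•(𝓤, G)` (strictly perfect, quasi-iso)
  for any finite cover `𝓤` with affine finite intersections, the affine base change `Č•(𝓤, G) ⊗ Γ(B′) ≅ Č•(k⁻¹𝓤, k^*G)` of
  the module Čech complex along a cartesian square over an affine `j : B′ → B`, and the natural `H⁰`-representation
  `Γ(X′, k^*G) ≃ ker(d⁰ ⊗ Γ(B′))`;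
* ★ `Algebra/Module/KernelBaseChangeOfHOneVanishing` (B-p19): over a local ring, exactness of `Č• ⊗ k` in degree `1` ALONE
  makes `B′ ⊗ H⁰(Č•) → H⁰(Č• ⊗ B′)` onto (and `H¹(Č• ⊗ B′) = 0`) for every algebra `B′` — Mumford §5 Cor. 3 /
  Hartshorne III 12.11 at `i = 1` without higher vanishing (built on ★ `KernelBaseChangeDescent` / ★
  `VanishingBaseChangeOfQuasiIso`, B-p04);
* ★ `Modules/ModuleCechFiniteOfProper` (B-p19): ordered Leray `Ext¹(𝒪_{X₀}, G₀) ≃ H¹(Č•(𝓤₀, G₀))` on the fibre,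

this file proves:

* §1 `exists_finite_affine_cover_cechOpen` — a proper scheme over an affine base has a finite affine cover with affine
  non-empty finite intersections;
* §2 `function_exact_baseChange_cechComplex_of_subsingleton_ext` — for a cartesian square over an affine `j₀ : B₀ → B`,
  `Ext¹(𝒪_{X₀}, k₀^*G) = 0` ⇒ `Č•(𝓤, G) ⊗_{Γ(B)} Γ(B₀)` exact in degree `1`;
* §3 (the fibre hypothesis as `hfib`: `Č•(𝓤, G) ⊗ k` exact in degree `1` for the residue field `k` of `Γ(B, 𝒪_B)`)
  `range_kerSubtype_baseChange_cechComplex_eq_ker`, `function_exact_baseChange_cechComplex`,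
  **`span_unitSectionLE_top_eq_top`** — for EVERY cartesian square over an affine `j : B′ → B`, `Γ(X′, k^*G)` is spanned over
  `Γ(B′, 𝒪)` by the pulled-back global sections `η(t)`, `t ∈ Γ(X, G)` («`Γ(B′) ⊗ Γ(X, G) → Γ(X′, G′)` is onto»), and
  **`surjective_unitSectionLE_top_of_surjective`** — if `j♯` is onto (the closed point), `t ↦ η(t)` is onto: EVERY SECTION
  ON THE FIBRE LIFTS;
* §4 the cover-free HEADLINES with the fibre hypothesis `Ext¹(𝒪_{X₀}, G|_{X₀}) = 0` and the residue field identified with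
  `Γ(B₀, 𝒪)` by a `Γ(B)`-linear `e₀`: **`surjective_unitSectionLE_top_of_subsingleton_ext`** (Mumford §5 Cor. 3 (ii) /
  Hartshorne III 12.11 (b) at `q = 1` / EGA III 7.7.10) and **`span_unitSectionLE_top_eq_top_of_subsingleton_ext`**.

Everything is proved; no named facts.  Sections are written in the `SecMod G ρ ⊤` currency of `Modules/ModuleCechComplex`
(`= Γ(G, ⊤)` as a `Γ(B, 𝒪_B)`-module through `g♯ = g.appTop.hom`), ring maps of base changes in `appLE ⊤ ⊤` form (as in
★ `Modules/AffineTestObjects`).  Universe `Scheme.{0}`.  Mathlib searched (pin): `Scheme.affineCover.finiteSubcover`,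
`IsAffineOpen.biInf`, `IsAffineOpen.preimage`, `MorphismProperty.of_isPullback` (`IsAffineHom`),
`HomologicalComplex.exactAt_iff_isZero_homology`, `Submodule.span_induction` (used); no cohomology-and-base-change in
Mathlib.  Cell `hodgecm-mathlib`, F-DAG (h2) «cohomology and base change» geometric glue (B-p04 (g18) author, closed;
B-p19 (g14)); consumer B-p20 (g10) leaf (B) `RelativelyVeryAmpleNearFibre` (the (β) input «sections of `X_s` lift»);
generic, count-neutral, books 0.  HC_CM is proved only modulo the 7 printed citations until rung 0 closes — nothing here
bears on a summit statement.

## References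

* D. Mumford, *Abelian Varieties*, TIFR Studies in Mathematics 5 (1970), §5, Lemma 2 (p. 49), Cor. 3 (p. 53). [MumfordAV1970]
* R. Hartshorne, *Algebraic Geometry*, GTM 52 (1977), III Prop. 8.7, III Thm. 12.11 (p. 290). [Hartshorne1977]
* U. Görtz, T. Wedhorn, *Algebraic Geometry II: Cohomology of Schemes* (2023), Thm. 22.9 (p. 236); Prop. 22.90 (p. 277),
  proof; Cor. 23.135 (p. 355). [GortzWedhorn2023]
* A. Grothendieck, EGA III₂ (Publ. Math. IHÉS 17, 1963), 7.7.5, 7.7.10. [EGAIII2]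
-/

noncomputable section

set_option backward.isDefEq.respectTransparency false

open CategoryTheory CategoryTheory.Limits CategoryTheory.Abelian Opposite TopologicalSpace AlgebraicGeometry TensorProduct
open Literature.Algebra.Homology Literature.Algebra.Module

namespace Literature.AlgebraicGeometry.Morphisms

open Literature.AlgebraicGeometry.Modules Literature.AlgebraicGeometry.HodgeTheory Literature.AlgebraicGeometry.Motives

/-! ## §1 A finite affine cover with affine finite intersections -/

/-- A proper scheme over an affine base has a finite affine open cover all of whose non-empty finite intersections are
affine (it is quasi-compact and separated). [cite: Hartshorne1977, III Prop. 8.7 (proof)] -/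
theorem exists_finite_affine_cover_cechOpen {X B : Scheme.{0}} (g : X ⟶ B) [IsAffine B] [IsProper g] :
    ∃ (ι : Type) (_ : Fintype ι) (_ : LinearOrder ι) (U : ι → X.Opens), (⨆ i, U i) = ⊤ ∧
      ∀ s : Finset ι, s.Nonempty → IsAffineOpen (cechOpen U s) := by
  haveI : CompactSpace X := QuasiCompact.compactSpace_of_compactSpace g
  haveI : X.IsSeparated := by
    rw [Scheme.isSeparated_iff, ← terminal.comp_from g]; infer_instance
  let 𝒰 := X.affineCover.finiteSubcover
  letI : Fintype 𝒰.I₀ := Fintype.ofFinite _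
  letI : LinearOrder 𝒰.I₀ := LinearOrder.lift' (Fintype.equivFin 𝒰.I₀) (Fintype.equivFin 𝒰.I₀).injective
  have hUi : ∀ i, IsAffineOpen (𝒰.f i).opensRange := fun i => isAffineOpen_opensRange (𝒰.f i)
  refine ⟨𝒰.I₀, inferInstance, inferInstance, fun i => (𝒰.f i).opensRange, 𝒰.iSup_opensRange, fun s hs => ?_⟩
  rw [← faceSet_eq_cechOpen]
  exact IsAffineOpen.biInf (s : Set 𝒰.I₀) s.finite_toSet hs fun i _ => hUi i

/-! ## §2 The fibre hypothesis: from `Ext¹ = 0` on the fibre to the exactness of `Č• ⊗ k` in degree `1` -/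

section Fibre

variable {X B X₀ B₀ : Scheme.{0}} {g : X ⟶ B} {g₀ : X₀ ⟶ B₀} {k₀ : X₀ ⟶ X} {j₀ : B₀ ⟶ B}
  [IsAffine B] [IsAffine B₀] (H₀ : IsPullback k₀ g₀ g j₀)
  {ι : Type} [LinearOrder ι] [Fintype ι] (U : ι → X.Opens) (hcov : ⨆ i, U i = ⊤)
  (hUa : ∀ s : Finset ι, s.Nonempty → IsAffineOpen (cechOpen U s)) (G : X.Modules)

include H₀ hcov hUa in
/-- **`Ext¹(𝒪_{X₀}, k₀^*G) = 0` ⇒ `Č•(𝓤, G) ⊗_{Γ(B)} Γ(B₀)` is exact in degree `1`**, for a cartesian square over an affine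
`j₀ : B₀ → B` (e.g. the inclusion of the closed point): ordered Leray on `X₀` for the cover `k₀⁻¹𝓤`
(★ `Modules/ModuleCechFiniteOfProper.exists_ext_addEquiv_homology_cechComplex`) and the affine base change of the module Čech
complex (★ `Modules/GrothendieckComplexOfProper.exists_extendScalars_cechComplex_iso_of_isPullback`).
[cite: GortzWedhorn2023, Thm. 22.9 (p. 236); Prop. 22.90 (p. 277), proof] [cite: MumfordAV1970, §5, Lemma 2] -/
theorem function_exact_baseChange_cechComplex_of_subsingleton_ext (hG : IsAffineLocalizing G)
    (hvan : Subsingleton (Ext.{1} (unitModule X₀) ((Scheme.Modules.pullback k₀).obj G) 1)) :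
    letI := (j₀.appLE ⊤ ⊤ le_top).hom.toAlgebra
    Function.Exact (((cechComplex U G g.appTop.hom).d 0 1).hom.baseChange Γ(B₀, ⊤))
      (((cechComplex U G g.appTop.hom).d 1 2).hom.baseChange Γ(B₀, ⊤)) := by
  letI := (j₀.appLE ⊤ ⊤ le_top).hom.toAlgebra
  -- the pulled-back cover: affine non-empty intersections (`k₀` is affine, being a base change of `j₀`)
  haveI : IsAffineHom k₀ := MorphismProperty.of_isPullback (P := @IsAffineHom) H₀.flip inferInstance
  have hcov₀ : ⨆ i, k₀ ⁻¹ᵁ U i = ⊤ := by rw [← Scheme.Hom.preimage_iSup, hcov, Scheme.Hom.preimage_top]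
  have hUa₀ : ∀ s : Finset ι, s.Nonempty → IsAffineOpen (cechOpen (fun i => k₀ ⁻¹ᵁ U i) s) := fun s hs => by
    rw [← preimage_cechOpen]
    exact (hUa s hs).preimage k₀
  -- Leray on `X₀`: `Ext¹ ≃ H¹(Č•(k₀⁻¹𝓤, k₀^*G))`, so the latter vanishes
  obtain ⟨f, -⟩ := exists_ext_addEquiv_homology_cechComplex g₀ (fun i => k₀ ⁻¹ᵁ U i) hcov₀ hUa₀
    ((Scheme.Modules.pullback k₀).obj G) (hG.pullback k₀) 0
  haveI : Subsingleton
      ((cechComplex (fun i => k₀ ⁻¹ᵁ U i) ((Scheme.Modules.pullback k₀).obj G) g₀.appTop.hom).homology 1) :=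
    f.symm.toEquiv.subsingleton
  have h0 : IsZero ((cechComplex (fun i => k₀ ⁻¹ᵁ U i) ((Scheme.Modules.pullback k₀).obj G) g₀.appTop.hom).homology 1) :=
    ModuleCat.isZero_of_subsingleton _
  -- transport along the base-change isomorphism `Φ : Č•(𝓤, G) ⊗ Γ(B₀) ≅ Č•(k₀⁻¹𝓤, k₀^*G)`
  obtain ⟨Φ⟩ := nonempty_extendScalars_cechComplex_iso_of_isPullback H₀ U hUa G hG
  have h1 : (((ModuleCat.extendScalars (j₀.appLE ⊤ ⊤ le_top).hom).mapHomologicalComplex (ComplexShape.up ℤ)).obj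
      (cechComplex U G g.appTop.hom)).ExactAt 1 := by
    rw [HomologicalComplex.exactAt_iff_isZero_homology]
    exact h0.of_iso ((HomologicalComplex.homologyFunctor _ _ 1).mapIso Φ)
  have h2 := (exactAt_extendScalars_iff (j₀.appLE ⊤ ⊤ le_top).hom (cechComplex U G g.appTop.hom) 1).1 h1
  exact h2

end Fibre

/-! ## §3 Sections lift, and `H⁰` base change is onto, from `H¹` of the fibre complex alone -/

section Lift

variable {X B : Scheme.{0}} (g : X ⟶ B) [IsAffine B] [IsProper g] [IsLocallyNoetherian B] [Flat g]
  [IsLocalRing Γ(B, ⊤)]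
  {ι : Type} [LinearOrder ι] [Fintype ι] (U : ι → X.Opens) (hcov : ⨆ i, U i = ⊤)
  (hUa : ∀ s : Finset ι, s.Nonempty → IsAffineOpen (cechOpen U s)) (G : X.Modules) (hL : IsFiniteLocallyFree G)
  (hfib : Function.Exact
    (((cechComplex U G g.appTop.hom).d 0 1).hom.baseChange (IsLocalRing.ResidueField Γ(B, ⊤)))
    (((cechComplex U G g.appTop.hom).d 1 2).hom.baseChange (IsLocalRing.ResidueField Γ(B, ⊤))))

include hcov hUa hL hfib in
/-- **`H⁰(Č•) ⊗ A′ ↠ ker(d⁰ ⊗ A′)` for every algebra `A′`** over the LOCAL base ring, from the degree-`1` fibre exactness alone: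
the Grothendieck complex of ★ `Modules/GrothendieckComplexOfProper` fed into ★
`Algebra/Module/KernelBaseChangeOfHOneVanishing`. [cite: MumfordAV1970, §5 Cor. 3 (p. 53)] [cite: Hartshorne1977, III Thm. 12.11 (p. 290)] -/
theorem range_kerSubtype_baseChange_cechComplex_eq_ker (A' : Type) [CommRing A'] [Algebra Γ(B, ⊤) A'] :
    LinearMap.range ((LinearMap.ker ((cechComplex U G g.appTop.hom).d 0 1).hom).subtype.baseChange A') =
      LinearMap.ker (((cechComplex U G g.appTop.hom).d 0 1).hom.baseChange A') := by
  obtain ⟨K, ψ, hψ, hGE, hLE, hK⟩ :=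
    exists_strictlyPerfect_quasiIso_cechComplex_of_isProper g U hcov hUa G hL (Fintype.card ι) (by omega)
  haveI := hψ
  haveI := hGE
  haveI := hLE
  haveI : (cechComplex U G g.appTop.hom).IsStrictlyLE (Fintype.card ι : ℤ) :=
    isStrictlyLE_cechComplex U G _ (Fintype.card ι) (by omega)
  haveI : (cechComplex U G g.appTop.hom).IsStrictlyGE 0 := isStrictlyGE_cechComplex U G _
  exact range_kerSubtype_baseChange_eq_ker_of_quasiIso_of_exact_one ψ (Fintype.card ι : ℤ) hK
    (flat_cechComplex_X U G _ (flat_secMod_of_flat g U hUa G hL)) hfib A'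

include hcov hUa hL hfib in
/-- **`H¹(Č• ⊗ A′) = 0` for every algebra `A′`** over the local base ring, from the degree-`1` fibre exactness alone.
[cite: MumfordAV1970, §5 Cor. 3 (p. 53)] [cite: Hartshorne1977, III Thm. 12.11 (p. 290)] -/
theorem function_exact_baseChange_cechComplex (A' : Type) [CommRing A'] [Algebra Γ(B, ⊤) A'] :
    Function.Exact (((cechComplex U G g.appTop.hom).d 0 1).hom.baseChange A')
      (((cechComplex U G g.appTop.hom).d 1 2).hom.baseChange A') := by
  obtain ⟨K, ψ, hψ, hGE, hLE, hK⟩ :=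
    exists_strictlyPerfect_quasiIso_cechComplex_of_isProper g U hcov hUa G hL (Fintype.card ι) (by omega)
  haveI := hψ
  haveI := hLE
  haveI : (cechComplex U G g.appTop.hom).IsStrictlyLE (Fintype.card ι : ℤ) :=
    isStrictlyLE_cechComplex U G _ (Fintype.card ι) (by omega)
  exact exact_baseChange_one_of_quasiIso_of_exact_residueField_one ψ (Fintype.card ι : ℤ) hK
    (flat_cechComplex_X U G _ (flat_secMod_of_flat g U hUa G hL)) hfib A'

variable {X' B' : Scheme.{0}} {g' : X' ⟶ B'} {k : X' ⟶ X} {j : B' ⟶ B} [IsAffine B'] (H : IsPullback k g' g j)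

set_option maxHeartbeats 400000 in
include hcov hUa hL hfib H in
/-- **THE PULLED-BACK GLOBAL SECTIONS SPAN** (Mumford §5 Cor. 3 / Hartshorne III 12.11 / EGA III 7.7.10 at `q = 1`, geometric
form): `g : X → B` proper flat, `B` affine local noetherian, `G` finite locally free, and — for SOME finite cover `𝓤` of `X`
with affine finite intersections — `Č•(𝓤, G) ⊗ k` exact in degree `1` (`k` the residue field; see
`function_exact_baseChange_cechComplex_of_subsingleton_ext` for the input from `Ext¹(𝒪_{X₀}, G|_{X₀}) = 0`).  Then for
EVERY cartesian square over an affine `j : B′ → B`, the `Γ(B′, 𝒪)`-module `Γ(X′, k^*G)` is SPANNED by the pulled-back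
global sections `η(t)`, `t ∈ Γ(X, G)` («`Γ(B′) ⊗ Γ(X, G) → Γ(X′, G′)` is onto»).
[cite: MumfordAV1970, §5 Cor. 3 (p. 53)] [cite: Hartshorne1977, III Thm. 12.11 (p. 290)] [cite: GortzWedhorn2023, Cor. 23.135 (p. 355)] -/
theorem span_unitSectionLE_top_eq_top :
    letI := (j.appLE ⊤ ⊤ le_top).hom.toAlgebra
    Submodule.span Γ(B', ⊤) (Set.range fun t : SecMod G g.appTop.hom ⊤ =>
      SecMod.mk (ρ := g'.appTop.hom) (unitSectionLE k G (V := ⊤) (U := ⊤) le_top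
        (SecMod.val (L := G) (ρ := g.appTop.hom) t))) = ⊤ := by
  letI := (j.appLE ⊤ ⊤ le_top).hom.toAlgebra
  haveI := hL.isVectorBundle.1
  have hG : IsAffineLocalizing G := IsAffineLocalizing.of_isQuasicoherent G
  set ρ : Γ(B, ⊤) →+* Γ(X, ⊤) := g.appTop.hom with hρ
  set ρ' : Γ(B', ⊤) →+* Γ(X', ⊤) := g'.appTop.hom with hρ'
  set η : SecMod G ρ ⊤ → SecMod ((Scheme.Modules.pullback k).obj G) ρ' ⊤ := fun t =>
    SecMod.mk (ρ := ρ') (unitSectionLE k G (V := ⊤) (U := ⊤) le_top (SecMod.val (L := G) (ρ := ρ) t)) with hη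
  obtain ⟨e', he'⟩ := exists_secMod_top_linearEquiv_ker_baseChange H U hUa G hcov hG
  have hrange := range_kerSubtype_baseChange_cechComplex_eq_ker g U hcov hUa G hL hfib Γ(B', ⊤)
  have hd : ((cechComplex U G ρ).d 0 1).hom = OrderedCech.sysD (sectionsSystem U G ρ) 0 := by
    change ((cechComplex U G ρ).d 0 (0 + 1)).hom = _
    rw [OrderedCech.sysComplex_d]
    rfl
  rw [hd] at hrange
  -- every `B' ⊗ Z⁰`-element is hit by the span
  have key : ∀ y : Γ(B', ⊤) ⊗[Γ(B, ⊤)] LinearMap.ker (OrderedCech.sysD (sectionsSystem U G ρ) 0),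
      ∃ u ∈ Submodule.span Γ(B', ⊤) (Set.range η),
        ((e' u : LinearMap.ker ((OrderedCech.sysD (sectionsSystem U G ρ) 0).baseChange Γ(B', ⊤))) :
            Γ(B', ⊤) ⊗[Γ(B, ⊤)] OrderedCech.SysCochain (sectionsSystem U G ρ) 0) =
          (LinearMap.ker (OrderedCech.sysD (sectionsSystem U G ρ) 0)).subtype.baseChange Γ(B', ⊤) y := by
    intro y
    induction y using TensorProduct.induction_on with
    | zero => exact ⟨0, Submodule.zero_mem _, by rw [map_zero, map_zero]; rfl⟩
    | tmul b z =>
      refine ⟨b • η ((kerDZeroEquiv U G ρ hcov).symm z), Submodule.smul_mem _ _ (Submodule.subset_span ⟨_, rfl⟩), ?_⟩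
      rw [map_smul, Submodule.coe_smul, hη, he', LinearEquiv.apply_symm_apply, LinearMap.baseChange_tmul,
        Submodule.subtype_apply, TensorProduct.smul_tmul', smul_eq_mul, mul_one]
    | add x y hx hy =>
      obtain ⟨u, hu, hux⟩ := hx
      obtain ⟨v, hv, hvy⟩ := hy
      exact ⟨u + v, Submodule.add_mem _ hu hv, by rw [map_add, Submodule.coe_add, hux, hvy, map_add]⟩
  rw [eq_top_iff]
  rintro t' -
  have hmem : ((e' t' : LinearMap.ker ((OrderedCech.sysD (sectionsSystem U G ρ) 0).baseChange Γ(B', ⊤))) :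
      Γ(B', ⊤) ⊗[Γ(B, ⊤)] OrderedCech.SysCochain (sectionsSystem U G ρ) 0) ∈
      LinearMap.range ((LinearMap.ker (OrderedCech.sysD (sectionsSystem U G ρ) 0)).subtype.baseChange Γ(B', ⊤)) := by
    rw [hrange]
    exact (e' t').2
  obtain ⟨y, hy⟩ := hmem
  obtain ⟨u, hu, hue⟩ := key y
  have hut : u = t' := e'.injective (Subtype.ext (hue.trans hy))
  rw [← hut]
  exact hu

include hcov hUa hL hfib H in
/-- **EVERY SECTION OF `G` ON THE CLOSED FIBRE LIFTS TO `X`** (Mumford §5 Cor. 3 (ii) / Hartshorne III 12.11 (b), `q = 1`;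
EGA III 7.7.10): in the setting of `span_unitSectionLE_top_eq_top`, if moreover `j♯ : Γ(B) → Γ(B′)` is SURJECTIVE (e.g.
`B′ = Spec k` the closed point of the local base), then `t ↦ η(t) : Γ(X, G) → Γ(X′, k^*G)` is surjective.
[cite: MumfordAV1970, §5 Cor. 3 (p. 53)] [cite: Hartshorne1977, III Thm. 12.11 (p. 290)] -/
theorem surjective_unitSectionLE_top_of_surjective (hj : Function.Surjective (j.appLE ⊤ ⊤ le_top).hom) :
    Function.Surjective fun t : SecMod G g.appTop.hom ⊤ =>
      SecMod.mk (ρ := g'.appTop.hom) (unitSectionLE k G (V := ⊤) (U := ⊤) le_top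
        (SecMod.val (L := G) (ρ := g.appTop.hom) t)) := by
  letI := (j.appLE ⊤ ⊤ le_top).hom.toAlgebra
  set ρ : Γ(B, ⊤) →+* Γ(X, ⊤) := g.appTop.hom with hρ
  set ρ' : Γ(B', ⊤) →+* Γ(X', ⊤) := g'.appTop.hom with hρ'
  set η : SecMod G ρ ⊤ → SecMod ((Scheme.Modules.pullback k).obj G) ρ' ⊤ := fun t =>
    SecMod.mk (ρ := ρ') (unitSectionLE k G (V := ⊤) (U := ⊤) le_top (SecMod.val (L := G) (ρ := ρ) t)) with hη
  have hspan := span_unitSectionLE_top_eq_top g U hcov hUa G hL hfib H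
  -- `η` is additive and `j♯`-semilinear: `η (r • t) = j♯(r) • η t`
  have hadd : ∀ t₁ t₂, η (t₁ + t₂) = η t₁ + η t₂ := fun t₁ t₂ => by
    apply SecMod.val_injective (L := (Scheme.Modules.pullback k).obj G) (ρ := ρ')
    change unitSectionLE k G (V := ⊤) (U := ⊤) le_top
      (SecMod.val (L := G) (ρ := ρ) t₁ + SecMod.val (L := G) (ρ := ρ) t₂) = _
    rw [unitSectionLE_add]
    rfl
  have hsmul : ∀ (r : Γ(B, ⊤)) (t : SecMod G ρ ⊤), η (r • t) = (j.appLE ⊤ ⊤ le_top).hom r • η t := fun r t => by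
    apply SecMod.val_injective (L := (Scheme.Modules.pullback k).obj G) (ρ := ρ')
    change unitSectionLE k G (V := ⊤) (U := ⊤) le_top (toSections ρ ⊤ r • SecMod.val (L := G) (ρ := ρ) t) =
      toSections ρ' ⊤ ((j.appLE ⊤ ⊤ le_top).hom r) •
        unitSectionLE k G (V := ⊤) (U := ⊤) le_top (SecMod.val (L := G) (ρ := ρ) t)
    rw [unitSectionLE_smul]
    congr 1
    exact appLE_appLE_eq_of_comm_sq (US := ⊤) (UT := ⊤) (UX := ⊤) (UY := ⊤) H.w le_top (fun _ _ => trivial)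
      (by rw [Scheme.Hom.preimage_top, Scheme.Hom.preimage_top, top_inf_eq]) r
  intro t'
  have ht' : t' ∈ Submodule.span Γ(B', ⊤) (Set.range η) := by rw [hspan]; trivial
  refine Submodule.span_induction (p := fun x _ => ∃ t, η t = x) ?_ ?_ ?_ ?_ ht'
  · rintro _ ⟨t, rfl⟩; exact ⟨t, rfl⟩
  · refine ⟨0, ?_⟩
    have h := hadd 0 0
    rw [add_zero] at h
    exact left_eq_add.mp h
  · rintro _ _ _ _ ⟨t₁, rfl⟩ ⟨t₂, rfl⟩; exact ⟨t₁ + t₂, hadd t₁ t₂⟩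
  · rintro b _ _ ⟨t, rfl⟩
    obtain ⟨r, rfl⟩ := hj b
    exact ⟨r • t, hsmul r t⟩

end Lift

/-! ## §4 Cover-free headline statements: the closed fibre as a cartesian square identified with the residue field -/

section Headline

variable {X B : Scheme.{0}} (g : X ⟶ B) [IsAffine B] [IsProper g] [IsLocallyNoetherian B] [Flat g]
  [IsLocalRing Γ(B, ⊤)] (G : X.Modules) (hL : IsFiniteLocallyFree G)
  {X₀ B₀ : Scheme.{0}} {g₀ : X₀ ⟶ B₀} {k₀ : X₀ ⟶ X} {j₀ : B₀ ⟶ B} [IsAffine B₀] (H₀ : IsPullback k₀ g₀ g j₀)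
  (e₀ : letI := (j₀.appLE ⊤ ⊤ le_top).hom.toAlgebra
    IsLocalRing.ResidueField Γ(B, ⊤) ≃ₗ[Γ(B, ⊤)] Γ(B₀, ⊤))
  (hvan : Subsingleton (Ext.{1} (unitModule X₀) ((Scheme.Modules.pullback k₀).obj G) 1))

include H₀ e₀ hvan in
omit [IsProper g] [IsLocallyNoetherian B] [Flat g] in
/-- The fibre hypothesis in residue-field form: for a cartesian square over an affine `j₀ : B₀ → B` whose ring map is
identified with the residue field of the local ring `Γ(B, 𝒪_B)` by `e₀`, `Ext¹(𝒪_{X₀}, k₀^*G) = 0` gives the exactness of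
`Č•(𝓤, G) ⊗ k` in degree `1` for ANY finite cover `𝓤` of `X` with affine finite intersections.
[cite: MumfordAV1970, §5 Cor. 3 (p. 53)] [cite: GortzWedhorn2023, Thm. 22.9 (p. 236)] -/
theorem function_exact_baseChange_residueField_of_subsingleton_ext
    {ι : Type} [LinearOrder ι] [Fintype ι] (U : ι → X.Opens) (hcov : ⨆ i, U i = ⊤)
    (hUa : ∀ s : Finset ι, s.Nonempty → IsAffineOpen (cechOpen U s)) (hG : IsAffineLocalizing G) :
    Function.Exact
      (((cechComplex U G g.appTop.hom).d 0 1).hom.baseChange (IsLocalRing.ResidueField Γ(B, ⊤)))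
      (((cechComplex U G g.appTop.hom).d 1 2).hom.baseChange (IsLocalRing.ResidueField Γ(B, ⊤))) :=
  letI := (j₀.appLE ⊤ ⊤ le_top).hom.toAlgebra
  (function_exact_baseChange_iff_of_linearEquiv e₀ _ _).2
    (function_exact_baseChange_cechComplex_of_subsingleton_ext H₀ U hcov hUa G hG hvan)

include H₀ e₀ hvan hL in
/-- **SECTIONS OF A VECTOR BUNDLE ON THE CLOSED FIBRE LIFT** (Mumford, *Abelian Varieties*, §5 Cor. 3; Hartshorne III
Thm. 12.11 at `i = 1`; EGA III 7.7.10): `g : X → B` proper and flat over an affine base with LOCAL noetherian ring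
`Γ(B, 𝒪_B)`, `G` finite locally free on `X`, `X₀ = X ×_B B₀ → B₀` the closed fibre (any cartesian square over an affine
`j₀ : B₀ → B` with `j₀♯` onto and identified with the residue field by `e₀`).  If `Ext¹_{𝒪_{X₀}}(𝒪_{X₀}, G|_{X₀}) = 0` — ONLY
`H¹` — then every global section of `G|_{X₀}` is the restriction `η(t)` of a global section `t` of `G`.
[cite: MumfordAV1970, §5 Cor. 3 (p. 53)] [cite: Hartshorne1977, III Thm. 12.11 (p. 290)] -/
theorem surjective_unitSectionLE_top_of_subsingleton_ext (hj₀ : Function.Surjective (j₀.appLE ⊤ ⊤ le_top).hom) :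
    Function.Surjective fun t : SecMod G g.appTop.hom ⊤ =>
      SecMod.mk (ρ := g₀.appTop.hom) (unitSectionLE k₀ G (V := ⊤) (U := ⊤) le_top
        (SecMod.val (L := G) (ρ := g.appTop.hom) t)) := by
  obtain ⟨ι, _, _, U, hcov, hUa⟩ := exists_finite_affine_cover_cechOpen g
  haveI := hL.isVectorBundle.1
  have hG : IsAffineLocalizing G := IsAffineLocalizing.of_isQuasicoherent G
  exact surjective_unitSectionLE_top_of_surjective g U hcov hUa G hL
    (function_exact_baseChange_residueField_of_subsingleton_ext g G H₀ e₀ hvan U hcov hUa hG) H₀ hj₀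

include H₀ e₀ hvan hL in
/-- **`H⁰` AND BASE CHANGE, surjectivity for every affine base change** (same hypotheses): for EVERY cartesian square
`X′ = X ×_B B′ → B′` over an affine `j : B′ → B`, the `Γ(B′, 𝒪)`-module `Γ(X′, G|_{X′})` is spanned by the pulled-back
global sections of `G` — `Γ(B′) ⊗_{Γ(B)} Γ(X, G) → Γ(X′, G|_{X′})` is onto. [cite: MumfordAV1970, §5 Cor. 3 (p. 53)] [cite: Hartshorne1977, III Thm. 12.11 (p. 290)] -/
theorem span_unitSectionLE_top_eq_top_of_subsingleton_ext
    {X' B' : Scheme.{0}} {g' : X' ⟶ B'} {k : X' ⟶ X} {j : B' ⟶ B} [IsAffine B'] (H : IsPullback k g' g j) :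
    letI := (j.appLE ⊤ ⊤ le_top).hom.toAlgebra
    Submodule.span Γ(B', ⊤) (Set.range fun t : SecMod G g.appTop.hom ⊤ =>
      SecMod.mk (ρ := g'.appTop.hom) (unitSectionLE k G (V := ⊤) (U := ⊤) le_top
        (SecMod.val (L := G) (ρ := g.appTop.hom) t))) = ⊤ := by
  obtain ⟨ι, _, _, U, hcov, hUa⟩ := exists_finite_affine_cover_cechOpen g
  haveI := hL.isVectorBundle.1
  have hG : IsAffineLocalizing G := IsAffineLocalizing.of_isQuasicoherent G
  exact span_unitSectionLE_top_eq_top g U hcov hUa G hL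
    (function_exact_baseChange_residueField_of_subsingleton_ext g G H₀ e₀ hvan U hcov hUa hG) H

end Headline

end Literature.AlgebraicGeometry.Morphisms

end
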